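import Summits.Ventures.PercRepro2.CaseOneParallelMerge

/-!
# Suppressing an unmarked vertex of degree two: every case-1 quantity elsewhere is unchanged
(blind cell PercRepro2, p1 g22; S5 §2.2: the «series» reduction rule as a kernel transfer — with the
leaf deletion of `CaseOneLeafDelete` and the parallel merge of `CaseOneParallelMerge` all three typed
reduction rules are kernel transfers)

A vertex `w` carrying exactly the two edges `e₀ = {x, w}` and `e₁ = {w, z}` (`IsSeriesAt`) is, for every
connection among the other vertices, one edge `{x, z}` of weight `p e₀ · p e₁`: the map
`seriesCfg e₀ e₁ : Config E → Config {e // e ≠ e₁}` declares `e₀` open iff both `e₀` and `e₁` are open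
and keeps every other edge, `seriesEnds` re-points `e₀` to `{x, z}`, `seriesW` gives it the weight
`p e₀ · p e₁`. Then
* connections among vertices `≠ w` are the same (`conn_series_iff`, by the closure lemma
  `mem_of_conn_of_closed` in both directions: a path through `w` uses both edges, the merged edge is open
  exactly then), `connEvent_series`;
* the product law pushes forward (`expect_series`, `prob_series`): the two pinnings of the parallel case
  with `∧` in place of `∨`, and `p e₀ · p e₁` in place of `p e₀ + p e₁ − p e₀ p e₁`.
Hence every case-1 quantity at a vertex `≠ w` with marks `≠ w` is unchanged (`Dpd_series`, …,
`iExprT_series`); the four Props transfer in both directions in `CaseOneSeriesProps`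
(`zSplitII_series_iff`, …, the `_of_series` directions). Own code; standard axioms. -/

namespace Summit.Ventures.PercRepro2

namespace CaseOne

/-! ## The series vertex, the contracted configuration, ends and weights -/

section SeriesDefs
variable {V : Type*} {E : Type*} [DecidableEq E] {R : Type*} [CommRing R]

/-- **`w` is a vertex of degree two in series**: its edges are exactly `e₀ = {x, w}` and `e₁ = {w, z}`. -/
structure IsSeriesAt (ends : E → Sym2 V) (x w z : V) (e₀ e₁ : E) : Prop where
  /-- the first edge -/
  ends_zero : ends e₀ = s(x, w)
  /-- the second edge -/
  ends_one : ends e₁ = s(w, z)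
  /-- two distinct edges -/
  ne : e₀ ≠ e₁
  /-- no other edge at `w` -/
  unique : ∀ e, w ∈ ends e → e = e₀ ∨ e = e₁
  /-- `x ≠ w` -/
  x_ne : x ≠ w
  /-- `z ≠ w` -/
  z_ne : z ≠ w

/-- The configuration of `G − e₁` in which `e₀` is open iff both `e₀` and `e₁` are open in `ω`. -/
def seriesCfg (e₀ e₁ : E) (ω : Config E) : Config {e : E // e ≠ e₁} :=
  fun e => if e.1 = e₀ then (ω e₀ && ω e₁) else ω e.1

/-- The ends of `G − e₁` with `e₀` re-pointed to `{x, z}`. -/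
def seriesEnds (ends : E → Sym2 V) (e₀ e₁ : E) (x z : V) : {e : E // e ≠ e₁} → Sym2 V :=
  fun e => if e.1 = e₀ then s(x, z) else ends e.1

/-- The weights of `G − e₁` with the product weight `p e₀ · p e₁` at `e₀`. -/
def seriesW (p : E → R) (e₀ e₁ : E) : {e : E // e ≠ e₁} → R :=
  fun e => if e.1 = e₀ then p e₀ * p e₁ else p e.1

variable {ends : E → Sym2 V} {x w z : V} {e₀ e₁ : E}

omit [DecidableEq E] [CommRing R] in
/-- An edge at `w` is `e₀` with the other end `x`, or `e₁` with the other end `z`. -/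
lemma IsSeriesAt.edge_cases (h : IsSeriesAt ends x w z e₀ e₁) {e : E} {y : V}
    (he : ends e = s(w, y)) : (e = e₀ ∧ y = x) ∨ (e = e₁ ∧ y = z) := by
  have hw : w ∈ ends e := by
    rw [he]
    exact Sym2.mem_mk_left w y
  rcases h.unique e hw with rfl | rfl
  · left
    refine ⟨rfl, ?_⟩
    rw [h.ends_zero, Sym2.eq_iff] at he
    rcases he with ⟨hxw, -⟩ | ⟨hxy, -⟩
    · exact absurd hxw h.x_ne
    · exact hxy.symm
  · right
    refine ⟨rfl, ?_⟩
    rw [h.ends_one, Sym2.eq_iff] at he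
    rcases he with ⟨-, hzy⟩ | ⟨-, hzw⟩
    · exact hzy.symm
    · exact absurd hzw h.z_ne

omit [DecidableEq E] [CommRing R] in
/-- An edge not at `w` is neither `e₀` nor `e₁`. -/
lemma IsSeriesAt.ne_of_not_mem (h : IsSeriesAt ends x w z e₀ e₁) {e : E} (he : w ∉ ends e) :
    e ≠ e₀ ∧ e ≠ e₁ := by
  constructor
  · rintro rfl
    exact he (by rw [h.ends_zero]; exact Sym2.mem_mk_right x w)
  · rintro rfl
    exact he (by rw [h.ends_one]; exact Sym2.mem_mk_left w z)

omit [CommRing R] in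
/-- **Connections among vertices other than `w` are the same in `G` and in the contracted graph.** -/
theorem conn_series_iff (h : IsSeriesAt ends x w z e₀ e₁) (ω : Config E) {a b : V} (ha : a ≠ w)
    (hb : b ≠ w) :
    Conn ends ω a b ↔ Conn (seriesEnds ends e₀ e₁ x z) (seriesCfg e₀ e₁ ω) a b := by
  constructor
  · intro hab
    -- the closure set: the vertices `≠ w` reached in the contracted graph, and `w` itself when it is
    -- entered through an open edge from a reached end
    let S : Set V := {u | (u ≠ w ∧ Conn (seriesEnds ends e₀ e₁ x z) (seriesCfg e₀ e₁ ω) a u) ∨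
      (u = w ∧ ((ω e₀ = true ∧ Conn (seriesEnds ends e₀ e₁ x z) (seriesCfg e₀ e₁ ω) a x) ∨
        (ω e₁ = true ∧ Conn (seriesEnds ends e₀ e₁ x z) (seriesCfg e₀ e₁ ω) a z)))}
    have hS : ∀ u ∈ S, ∀ y, (openGraph ends ω).Adj u y → y ∈ S := by
      intro u hu y hadj
      rw [openGraph_adj] at hadj
      obtain ⟨huy, e, he, hends⟩ := hadj
      by_cases hyw : y = w
      · -- entering `w`
        subst hyw
        have hu' : u ≠ y ∧ Conn (seriesEnds ends e₀ e₁ x z) (seriesCfg e₀ e₁ ω) a u := by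
          rcases hu with hu | ⟨huw, -⟩
          · exact hu
          · exact absurd huw huy
        have he' : ends e = s(y, u) := by rw [hends, Sym2.eq_swap]
        rcases h.edge_cases he' with ⟨rfl, rfl⟩ | ⟨rfl, rfl⟩
        · exact Or.inr ⟨rfl, Or.inl ⟨he, hu'.2⟩⟩
        · exact Or.inr ⟨rfl, Or.inr ⟨he, hu'.2⟩⟩
      · -- `y ≠ w`: the target is a vertex of the contracted graph
        refine Or.inl ⟨hyw, ?_⟩
        rcases hu with ⟨huw, hcu⟩ | ⟨rfl, hw⟩
        · -- an edge between two vertices `≠ w` is an edge of the contracted graph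
          have hnot : w ∉ ends e := by
            rw [hends, Sym2.mem_iff]
            rintro (rfl | rfl)
            · exact huw rfl
            · exact hyw rfl
          obtain ⟨hne0, hne1⟩ := h.ne_of_not_mem hnot
          refine conn_trans hcu (conn_of_openAdj ⟨⟨e, hne1⟩, ?_, ?_⟩)
          · simp [seriesCfg, hne0, he]
          · simp [seriesEnds, hne0, hends]
        · -- leaving `w` through `e₀` or `e₁`
          rcases h.edge_cases hends with ⟨rfl, rfl⟩ | ⟨rfl, rfl⟩
          · rcases hw with ⟨-, hcx⟩ | ⟨h1, hcz⟩
            · exact hcx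
            · refine conn_trans hcz (conn_of_openAdj ⟨⟨e, h.ne⟩, ?_, ?_⟩)
              · simp [seriesCfg, he, h1]
              · simp [seriesEnds, Sym2.eq_swap]
          · rcases hw with ⟨h0, hcx⟩ | ⟨-, hcz⟩
            · refine conn_trans hcx (conn_of_openAdj ⟨⟨e₀, h.ne⟩, ?_, ?_⟩)
              · simp [seriesCfg, he, h0]
              · simp [seriesEnds]
            · exact hcz
    have hbS : b ∈ S :=
      mem_of_conn_of_closed hS (Or.inl ⟨ha, conn_refl _ _ a⟩) hab
    rcases hbS with ⟨-, hcb⟩ | ⟨hbw, -⟩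
    · exact hcb
    · exact absurd hbw hb
  · intro hab
    let S : Set V := {u | Conn ends ω a u}
    have hS : ∀ u ∈ S, ∀ y, (openGraph (seriesEnds ends e₀ e₁ x z) (seriesCfg e₀ e₁ ω)).Adj u y →
        y ∈ S := by
      intro u hu y hadj
      rw [openGraph_adj] at hadj
      obtain ⟨-, ⟨e, hne1⟩, he, hends⟩ := hadj
      by_cases h0 : e = e₀
      · -- the merged edge: both `e₀` and `e₁` are open, so `x ↔ w ↔ z` in `G`
        have hboth : ω e₀ = true ∧ ω e₁ = true := by simpa [seriesCfg, h0] using he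
        have hxz : s(x, z) = s(u, y) := by simpa [seriesEnds, h0] using hends
        have hcxz : Conn ends ω x z :=
          conn_trans (conn_of_openAdj ⟨e₀, hboth.1, h.ends_zero⟩)
            (conn_of_openAdj ⟨e₁, hboth.2, h.ends_one⟩)
        rw [Sym2.eq_iff] at hxz
        rcases hxz with ⟨rfl, rfl⟩ | ⟨rfl, rfl⟩
        · exact conn_trans hu hcxz
        · exact conn_trans hu (conn_symm hcxz)
      · have he' : ω e = true := by simpa [seriesCfg, h0] using he
        have hends' : ends e = s(u, y) := by simpa [seriesEnds, h0] using hends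
        exact conn_trans hu (conn_of_openAdj ⟨e, he', hends'⟩)
    exact mem_of_conn_of_closed hS (conn_refl _ _ a) hab

omit [CommRing R] in
/-- The connection event among vertices `≠ w` is the preimage of the event in the contracted graph. -/
theorem connEvent_series (h : IsSeriesAt ends x w z e₀ e₁) {a b : V} (ha : a ≠ w) (hb : b ≠ w) :
    connEvent ends a b = seriesCfg e₀ e₁ ⁻¹' connEvent (seriesEnds ends e₀ e₁ x z) a b := by
  ext ω
  simp only [mem_connEvent, Set.mem_preimage]
  exact conn_series_iff h ω ha hb

end SeriesDefs

/-! ## The push-forward of the product law -/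

section SeriesMeasure
variable {E : Type*} [Fintype E] [DecidableEq E] {R : Type*} [CommRing R]

omit [Fintype E] in
/-- The contraction of a configuration pinned at `e₁` and then at `e₀` is the restriction updated at
`e₀` with the conjunction of the two pinned states. -/
lemma seriesCfg_update_update (e₀ e₁ : E) (hne : e₀ ≠ e₁) (ω : Config E) (c d : Bool) :
    seriesCfg e₀ e₁ (Function.update (Function.update ω e₁ d) e₀ c) =
      Function.update (restrictCfg e₁ ω) ⟨e₀, hne⟩ (c && d) := by
  funext e
  by_cases h : e = ⟨e₀, hne⟩
  · subst h
    simp [seriesCfg, Function.update_of_ne hne.symm]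
  · have h0 : e.1 ≠ e₀ := fun h' => h (Subtype.ext h')
    simp [seriesCfg, h0, Function.update_of_ne h, Function.update_of_ne e.2, restrictCfg]

omit [Fintype E] in
/-- The product weight at the merged edge. -/
lemma seriesW_self (p : E → R) (e₀ e₁ : E) (hne : e₀ ≠ e₁) :
    seriesW p e₀ e₁ ⟨e₀, hne⟩ = p e₀ * p e₁ := by
  simp [seriesW]

omit [Fintype E] in
/-- Off the merged edge the series weights are the restricted weights. -/
lemma seriesW_of_ne (p : E → R) (e₀ e₁ : E) (hne : e₀ ≠ e₁) (f : {e : E // e ≠ e₁})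
    (hf : f ≠ ⟨e₀, hne⟩) : seriesW p e₀ e₁ f = restrictW p e₁ f := by
  have h0 : f.1 ≠ e₀ := fun h' => hf (Subtype.ext h')
  simp [seriesW, restrictW, h0]

/-- **Push-forward of the product law under the contraction**: the expectation of a function of the
contracted configuration is its expectation under the series weights. -/
theorem expect_series (p : E → R) (e₀ e₁ : E) (hne : e₀ ≠ e₁) (f : Config {e : E // e ≠ e₁} → R) :
    expect p (fun ω => f (seriesCfg e₀ e₁ ω)) = expect (seriesW p e₀ e₁) f := by
  have key : ∀ c : Bool, expect p (fun ω => f (seriesCfg e₀ e₁ (Function.update ω e₀ c))) =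
      p e₁ * expect (restrictW p e₁) (fun ω' => f (Function.update ω' ⟨e₀, hne⟩ (c && true))) +
        (1 - p e₁) * expect (restrictW p e₁)
          (fun ω' => f (Function.update ω' ⟨e₀, hne⟩ (c && false))) := by
    intro c
    rw [expect_eq_update_pin p _ e₁]
    simp only [seriesCfg_update_update e₀ e₁ hne]
    rw [expect_restrict p e₁ (fun ω' => f (Function.update ω' ⟨e₀, hne⟩ (c && true))),
      expect_restrict p e₁ (fun ω' => f (Function.update ω' ⟨e₀, hne⟩ (c && false)))]
  have hL : expect p (fun ω => f (seriesCfg e₀ e₁ ω)) =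
      p e₀ * (p e₁ * expect (restrictW p e₁) (fun ω' => f (Function.update ω' ⟨e₀, hne⟩ true)) +
        (1 - p e₁) * expect (restrictW p e₁) (fun ω' => f (Function.update ω' ⟨e₀, hne⟩ false))) +
      (1 - p e₀) * (p e₁ * expect (restrictW p e₁) (fun ω' => f (Function.update ω' ⟨e₀, hne⟩ false)) +
        (1 - p e₁) * expect (restrictW p e₁) (fun ω' => f (Function.update ω' ⟨e₀, hne⟩ false))) := by
    rw [expect_eq_update_pin p _ e₀]
    rw [key true, key false]
    simp only [Bool.true_and, Bool.false_and]
  have hR : expect (seriesW p e₀ e₁) f =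
      (p e₀ * p e₁) * expect (restrictW p e₁) (fun ω' => f (Function.update ω' ⟨e₀, hne⟩ true)) +
        (1 - p e₀ * p e₁) *
          expect (restrictW p e₁) (fun ω' => f (Function.update ω' ⟨e₀, hne⟩ false)) := by
    rw [expect_eq_update_pin (seriesW p e₀ e₁) f ⟨e₀, hne⟩, seriesW_self p e₀ e₁ hne]
    have hT : expect (seriesW p e₀ e₁) (fun ω' => f (Function.update ω' ⟨e₀, hne⟩ true)) =
        expect (restrictW p e₁) (fun ω' => f (Function.update ω' ⟨e₀, hne⟩ true)) :=
      expect_congr_of_ignore _ _ ⟨e₀, hne⟩ (seriesW_of_ne p e₀ e₁ hne) _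
        (fun ω c => by simp only [Function.update_idem])
    have hF : expect (seriesW p e₀ e₁) (fun ω' => f (Function.update ω' ⟨e₀, hne⟩ false)) =
        expect (restrictW p e₁) (fun ω' => f (Function.update ω' ⟨e₀, hne⟩ false)) :=
      expect_congr_of_ignore _ _ ⟨e₀, hne⟩ (seriesW_of_ne p e₀ e₁ hne) _
        (fun ω c => by simp only [Function.update_idem])
    rw [hT, hF]
  rw [hL, hR]
  ring

/-- Push-forward of the product law under the contraction, for events. -/
theorem prob_series (p : E → R) (e₀ e₁ : E) (hne : e₀ ≠ e₁) (A : Set (Config {e : E // e ≠ e₁})) :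
    prob p (seriesCfg e₀ e₁ ⁻¹' A) = prob (seriesW p e₀ e₁) A := by
  rw [prob_eq_expect_indicator, prob_eq_expect_indicator, ← expect_series p e₀ e₁ hne]
  rfl

omit [Fintype E] in
/-- The series weights of a probability vector form a probability vector. -/
lemma IsProbVec.seriesW [LinearOrder R] [IsStrictOrderedRing R] {p : E → R} (hp : IsProbVec p)
    (e₀ e₁ : E) : IsProbVec (CaseOne.seriesW p e₀ e₁) := by
  refine ⟨fun e => ?_, fun e => ?_⟩
  · by_cases h : e.1 = e₀
    · have he : CaseOne.seriesW p e₀ e₁ e = p e₀ * p e₁ := by simp [CaseOne.seriesW, h]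
      rw [he]
      exact mul_nonneg (hp.nonneg e₀) (hp.nonneg e₁)
    · have he : CaseOne.seriesW p e₀ e₁ e = p e.1 := by simp [CaseOne.seriesW, h]
      rw [he]
      exact hp.nonneg e.1
  · by_cases h : e.1 = e₀
    · have he : CaseOne.seriesW p e₀ e₁ e = p e₀ * p e₁ := by simp [CaseOne.seriesW, h]
      rw [he]
      exact mul_le_one₀ (hp.le_one e₀) (hp.nonneg e₁) (hp.le_one e₁)
    · have he : CaseOne.seriesW p e₀ e₁ e = p e.1 := by simp [CaseOne.seriesW, h]
      rw [he]
      exact hp.le_one e.1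

end SeriesMeasure

/-! ## The case-1 quantities at a vertex `≠ w` -/

section Transfer
variable {V : Type*} {E : Type*} [Fintype E] [DecidableEq E] {R : Type*} [CommRing R]
variable {ends : E → Sym2 V} {o a₁ a₂ v b x w z : V} {e₀ e₁ : E}

/-- `D` is unchanged by suppressing a series vertex `w ∉ {a₁, a₂, v}`. -/
theorem Dpd_series (p : E → R) (h : IsSeriesAt ends x w z e₀ e₁) (h1 : a₁ ≠ w) (h2 : a₂ ≠ w)
    (hv : v ≠ w) :
    Dpd p ends a₁ a₂ v = Dpd (seriesW p e₀ e₁) (seriesEnds ends e₀ e₁ x z) a₁ a₂ v := by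
  unfold Dpd
  rw [connEvent_series h h1 hv, connEvent_series h h2 hv, connEvent_series h h1 h2]
  simp only [← Set.preimage_compl, ← Set.preimage_inter, prob_series p e₀ e₁ h.ne]

/-- `D_o` is unchanged by suppressing a series vertex `w ∉ {o, a₁, a₂, v}`. -/
theorem Dpdo_series (p : E → R) (h : IsSeriesAt ends x w z e₀ e₁) (ho : o ≠ w) (h1 : a₁ ≠ w)
    (h2 : a₂ ≠ w) (hv : v ≠ w) :
    Dpdo p ends o a₁ a₂ v = Dpdo (seriesW p e₀ e₁) (seriesEnds ends e₀ e₁ x z) o a₁ a₂ v := by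
  unfold Dpdo
  rw [connEvent_series h h1 ho, connEvent_series h h2 ho, connEvent_series h h1 hv,
    connEvent_series h h2 hv, connEvent_series h h1 h2]
  simp only [← Set.preimage_compl, ← Set.preimage_inter, ← Set.preimage_union,
    prob_series p e₀ e₁ h.ne]

/-- `P(Q, o ∈ U)` is unchanged by suppressing a series vertex `w ∉ {o, a₁, a₂}`. -/
theorem Dqo_series (p : E → R) (h : IsSeriesAt ends x w z e₀ e₁) (ho : o ≠ w) (h1 : a₁ ≠ w)
    (h2 : a₂ ≠ w) :
    Dqo p ends o a₁ a₂ = Dqo (seriesW p e₀ e₁) (seriesEnds ends e₀ e₁ x z) o a₁ a₂ := by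
  unfold Dqo
  rw [connEvent_series h h1 ho, connEvent_series h h2 ho, connEvent_series h h1 h2]
  simp only [← Set.preimage_compl, ← Set.preimage_inter, ← Set.preimage_union,
    prob_series p e₀ e₁ h.ne]

/-- `P(Q)` is unchanged by suppressing a series vertex `w ∉ {a₁, a₂}`. -/
theorem probQ_series (p : E → R) (h : IsSeriesAt ends x w z e₀ e₁) (h1 : a₁ ≠ w) (h2 : a₂ ≠ w) :
    prob p (connEvent ends a₁ a₂)ᶜ =
      prob (seriesW p e₀ e₁) (connEvent (seriesEnds ends e₀ e₁ x z) a₁ a₂)ᶜ := by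
  rw [connEvent_series h h1 h2, ← Set.preimage_compl, prob_series p e₀ e₁ h.ne]

/-- **`iiExpr` is unchanged by suppressing a series vertex `w ∉ {o, a₁, a₂, v, b}`.** -/
theorem iiExpr_series (p : E → R) (h : IsSeriesAt ends x w z e₀ e₁) (ho : o ≠ w) (h1 : a₁ ≠ w)
    (h2 : a₂ ≠ w) (hv : v ≠ w) (hb : b ≠ w) :
    iiExpr p ends o a₁ a₂ v b = iiExpr (seriesW p e₀ e₁) (seriesEnds ends e₀ e₁ x z) o a₁ a₂ v b := by
  rw [iiExpr_eq_probs, iiExpr_eq_probs, Dpd_series p h h1 h2 hv, Dpdo_series p h ho h1 h2 hv]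
  rw [connEvent_series h h2 hb, connEvent_series h h1 hv, connEvent_series h h2 ho,
    connEvent_series h h1 h2]
  simp only [← Set.preimage_compl, ← Set.preimage_inter, prob_series p e₀ e₁ h.ne]

/-- **`iExpr` is unchanged by suppressing a series vertex `w ∉ {o, a₁, a₂, v, b}`.** -/
theorem iExpr_series (p : E → R) (h : IsSeriesAt ends x w z e₀ e₁) (ho : o ≠ w) (h1 : a₁ ≠ w)
    (h2 : a₂ ≠ w) (hv : v ≠ w) (hb : b ≠ w) :
    iExpr p ends o a₁ a₂ v b = iExpr (seriesW p e₀ e₁) (seriesEnds ends e₀ e₁ x z) o a₁ a₂ v b := by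
  rw [iExpr_eq_iExprT, iExpr_eq_iExprT, iExprT_eq, iExprT_eq, Dpd_series p h h1 h2 hv,
    Dpdo_series p h ho h1 h2 hv]
  rw [connEvent_series h h1 hb, connEvent_series h h1 hv, connEvent_series h h2 ho,
    connEvent_series h h1 h2]
  simp only [← Set.preimage_compl, ← Set.preimage_inter, prob_series p e₀ e₁ h.ne]

/-- **`iiExprT` is unchanged by suppressing a series vertex `w ∉ {o, a₁, a₂, v, b}`** (any threshold
pair). -/
theorem iiExprT_series (p : E → R) (h : IsSeriesAt ends x w z e₀ e₁) (ho : o ≠ w) (h1 : a₁ ≠ w)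
    (h2 : a₂ ≠ w) (hv : v ≠ w) (hb : b ≠ w) (c₀ c₁ : R) :
    iiExprT p ends o a₁ a₂ v b c₀ c₁ =
      iiExprT (seriesW p e₀ e₁) (seriesEnds ends e₀ e₁ x z) o a₁ a₂ v b c₀ c₁ := by
  rw [iiExprT_eq, iiExprT_eq]
  rw [connEvent_series h h2 hb, connEvent_series h h1 hv, connEvent_series h h2 ho,
    connEvent_series h h1 h2]
  simp only [← Set.preimage_compl, ← Set.preimage_inter, prob_series p e₀ e₁ h.ne]

/-- **`iExprT` is unchanged by suppressing a series vertex `w ∉ {o, a₁, a₂, v, b}`** (any threshold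
pair). -/
theorem iExprT_series (p : E → R) (h : IsSeriesAt ends x w z e₀ e₁) (ho : o ≠ w) (h1 : a₁ ≠ w)
    (h2 : a₂ ≠ w) (hv : v ≠ w) (hb : b ≠ w) (c₀ c₁ : R) :
    iExprT p ends o a₁ a₂ v b c₀ c₁ =
      iExprT (seriesW p e₀ e₁) (seriesEnds ends e₀ e₁ x z) o a₁ a₂ v b c₀ c₁ := by
  rw [iExprT_eq, iExprT_eq]
  rw [connEvent_series h h1 hb, connEvent_series h h1 hv, connEvent_series h h2 ho,
    connEvent_series h h1 h2]
  simp only [← Set.preimage_compl, ← Set.preimage_inter, prob_series p e₀ e₁ h.ne]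

end Transfer

end CaseOne

end Summit.Ventures.PercRepro2
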